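import Mathlib
import Summits.Ventures.PercRepro2.HCov
import Summits.Ventures.PercRepro2.GcSkelReductionMinH

/-!
# Interior weights suffice: (HCOV) on the open cube `(0, 1)^E` gives (HCOV) on `[0, 1]^E`
(blind cell PercRepro2, typer-1 g55)

`Gc p ends o a₁ a₂ a₃ b` is a polynomial in the weights `p` (a sum of products of the edge
factors `p e`, `1 - p e`), hence continuous for the order topology of the ordered field `R`; the
open cube `(0, 1)^E` is dense in the closed cube `[0, 1]^E` (`closure_Ioo`, `closure_pi_set`),
so `{p | 0 ≤ Gc p}` closed and containing the open cube contains the closed cube: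

* `IsIntVec p` — interior weights (`0 < p e < 1` for every `e`); `IsIntVec.isProbVec`;
* `continuous_weight` / `continuous_prob` / `continuous_Gc` — continuity in `p` (any
  `[TopologicalSpace R] [OrderTopology R]`); the closure argument puts the order topology on `R`
  itself (`Preorder.topology`), so the statements below carry NO topological hypothesis;
* **`HCov_of_int`** — for a fixed graph and marks, (HCOV) at every interior weight gives (HCOV)
  at every admissible weight;
* the interior closures `HCov_int_all`, `HCovWRedMinH_int_all` and the equivalences
  **`HCov_all_iff_HCov_int_all`**, `HCovWRedMinH_all_iff_HCovWRedMinH_int_all`,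
  **`HCov_all_iff_HCovWRedMinH_int_all`**: the crux on the class of record at INTERIOR weights.

Why: at interior weights every configuration has positive weight, so the masses the cell keeps
division-free (`P(Q)`, `D = P(PD)`, …) are positive on every graph where the events are non-empty
— the non-degeneracy hypotheses of the division-based forms (`γ = D_o / D`, the conditional
laws) hold automatically, and a proof of (HCOV) under them extends to the boundary by this file.
-/

namespace Summit.Ventures.PercRepro2

open CovForm

/-! ## Interior weights -/

section IntVec

variable {E : Type*} {R : Type*} [CommRing R] [PartialOrder R]

/-- **Interior weights**: every `p e` lies in the open interval `(0, 1)`. -/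
structure IsIntVec (p : E → R) : Prop where
  /-- `0 < p e` -/
  pos : ∀ e, 0 < p e
  /-- `p e < 1` -/
  lt_one : ∀ e, p e < 1

/-- Interior weights are admissible. -/
lemma IsIntVec.isProbVec {p : E → R} (hp : IsIntVec p) : IsProbVec p :=
  ⟨fun e => (hp.pos e).le, fun e => (hp.lt_one e).le⟩

/-- The interior weight vectors are the open cube `(0, 1)^E`. -/
lemma isIntVec_iff_mem_pi {p : E → R} :
    IsIntVec p ↔ p ∈ Set.pi Set.univ (fun _ : E => Set.Ioo (0 : R) 1) := by
  constructor
  · intro hp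
    rw [Set.mem_univ_pi]
    exact fun e => ⟨hp.pos e, hp.lt_one e⟩
  · intro hp
    rw [Set.mem_univ_pi] at hp
    exact ⟨fun e => (hp e).1, fun e => (hp e).2⟩

/-- The admissible weight vectors are the closed cube `[0, 1]^E`. -/
lemma isProbVec_iff_mem_pi {p : E → R} :
    IsProbVec p ↔ p ∈ Set.pi Set.univ (fun _ : E => Set.Icc (0 : R) 1) := by
  constructor
  · intro hp
    rw [Set.mem_univ_pi]
    exact fun e => ⟨hp.nonneg e, hp.le_one e⟩
  · intro hp
    rw [Set.mem_univ_pi] at hp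
    exact ⟨fun e => (hp e).1, fun e => (hp e).2⟩

end IntVec

/-! ## Continuity of the masses in the weights -/

section Continuity

variable {V : Type*} {E : Type*} [Fintype E] [DecidableEq E] {R : Type*}
  [Field R] [LinearOrder R] [IsStrictOrderedRing R] [TopologicalSpace R] [OrderTopology R]

omit [Fintype E] [DecidableEq E] in
/-- The edge factor is continuous in the weight. -/
lemma continuous_edgeFactor (b : Bool) : Continuous fun q : R => edgeFactor q b := by
  cases b
  · exact (continuous_const.sub continuous_id : Continuous fun q : R => (1 : R) - q)
  · exact continuous_id

omit [DecidableEq E] in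
/-- The weight of a configuration is continuous in `p`. -/
lemma continuous_weight (ω : Config E) : Continuous fun p : E → R => weight p ω := by
  unfold weight
  exact continuous_finsetProd _ fun e _ => (continuous_edgeFactor (ω e)).comp (continuous_apply e)

/-- The probability of an event is continuous in `p`. -/
lemma continuous_prob (A : Set (Config E)) : Continuous fun p : E → R => prob p A := by
  unfold prob
  refine continuous_finsetSum _ fun ω _ => ?_
  by_cases h : ω ∈ A
  · simp only [Set.indicator_of_mem h]
    exact continuous_weight ω
  · simp only [Set.indicator_of_notMem h]
    exact continuous_const

/-- `E_Q[σ_b σ_o]` is continuous in `p`. -/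
lemma continuous_EQbo (ends : E → Sym2 V) (o a₁ a₂ b : V) :
    Continuous fun p : E → R => EQbo p ends o a₁ a₂ b := by
  unfold EQbo
  exact (((continuous_prob _).add (continuous_prob _)).sub (continuous_prob _)).sub
    (continuous_prob _)

/-- `E_Q[σ_b σ₃]` is continuous in `p`. -/
lemma continuous_EQb3 (ends : E → Sym2 V) (a₁ a₂ a₃ b : V) :
    Continuous fun p : E → R => EQb3 p ends a₁ a₂ a₃ b := by
  unfold EQb3
  exact (((continuous_prob _).add (continuous_prob _)).sub (continuous_prob _)).sub
    (continuous_prob _)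

/-- `E_Q[σ_b σ₃ 1_{o ∈ U}]` is continuous in `p`. -/
lemma continuous_EQb3o (ends : E → Sym2 V) (o a₁ a₂ a₃ b : V) :
    Continuous fun p : E → R => EQb3o p ends o a₁ a₂ a₃ b := by
  unfold EQb3o
  exact (((((((continuous_prob _).add (continuous_prob _)).add (continuous_prob _)).add
    (continuous_prob _)).sub (continuous_prob _)).sub (continuous_prob _)).sub
    (continuous_prob _)).sub (continuous_prob _)

/-- `E_Q[σ_o]` is continuous in `p`. -/
lemma continuous_EQo (ends : E → Sym2 V) (o a₁ a₂ : V) :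
    Continuous fun p : E → R => EQo p ends o a₁ a₂ := by
  unfold EQo
  exact (continuous_prob _).sub (continuous_prob _)

/-- `E_Q[σ₃]` is continuous in `p`. -/
lemma continuous_EQ3 (ends : E → Sym2 V) (a₁ a₂ a₃ : V) :
    Continuous fun p : E → R => EQ3 p ends a₁ a₂ a₃ := by
  unfold EQ3
  exact (continuous_prob _).sub (continuous_prob _)

/-- `E_Q[σ₃ 1_{o ∈ U}]` is continuous in `p`. -/
lemma continuous_EQ3o (ends : E → Sym2 V) (o a₁ a₂ a₃ : V) :
    Continuous fun p : E → R => EQ3o p ends o a₁ a₂ a₃ := by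
  unfold EQ3o
  exact (((continuous_prob _).add (continuous_prob _)).sub (continuous_prob _)).sub
    (continuous_prob _)

/-- `P(PD, b ∈ U)` is continuous in `p`. -/
lemma continuous_PDb (ends : E → Sym2 V) (a₁ a₂ a₃ b : V) :
    Continuous fun p : E → R => PDb p ends a₁ a₂ a₃ b := by
  unfold PDb
  exact (continuous_prob _).add (continuous_prob _)

/-- `P(PD, b ∈ U, o ∈ U)` is continuous in `p`. -/
lemma continuous_PDbo (ends : E → Sym2 V) (o a₁ a₂ a₃ b : V) :
    Continuous fun p : E → R => PDbo p ends o a₁ a₂ a₃ b := by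
  unfold PDbo
  exact (((continuous_prob _).add (continuous_prob _)).add (continuous_prob _)).add
    (continuous_prob _)

/-- `D_o` is continuous in `p`. -/
lemma continuous_Do (ends : E → Sym2 V) (o a₁ a₂ a₃ : V) :
    Continuous fun p : E → R => Do p ends o a₁ a₂ a₃ := by
  unfold Do
  exact (continuous_prob _).add (continuous_prob _)

/-- The labelling gap is continuous in `p`. -/
lemma continuous_gap (ends : E → Sym2 V) (a₁ a₂ b : V) :
    Continuous fun p : E → R => gap p ends a₁ a₂ b := by
  unfold gap
  exact (continuous_prob _).sub (continuous_prob _)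

/-- `D · E_Q[F]` is continuous in `p`. -/
lemma continuous_DEF (ends : E → Sym2 V) (o a₁ a₂ a₃ : V) :
    Continuous fun p : E → R => DEF p ends o a₁ a₂ a₃ := by
  unfold DEF
  exact (((continuous_prob _).mul (continuous_EQo ends o a₁ a₂)).add
    ((continuous_Do ends o a₁ a₂ a₃).mul (continuous_EQ3 ends a₁ a₂ a₃))).sub
    ((continuous_prob _).mul (continuous_EQ3o ends o a₁ a₂ a₃))

/-- **`Gc` is continuous in the weights** (a polynomial in `p`). -/
theorem continuous_Gc (ends : E → Sym2 V) (o a₁ a₂ a₃ b : V) :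
    Continuous fun p : E → R => Gc p ends o a₁ a₂ a₃ b := by
  unfold Gc
  exact (((continuous_prob _).mul
      ((((continuous_prob _).mul (continuous_EQbo ends o a₁ a₂ b)).add
        ((continuous_Do ends o a₁ a₂ a₃).mul (continuous_EQb3 ends a₁ a₂ a₃ b))).sub
        ((continuous_prob _).mul (continuous_EQb3o ends o a₁ a₂ a₃ b)))).add
      ((continuous_gap ends a₁ a₂ b).mul (continuous_DEF ends o a₁ a₂ a₃))).add
    ((continuous_prob _).mul
      (((continuous_Do ends o a₁ a₂ a₃).mul (continuous_PDb ends a₁ a₂ a₃ b)).sub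
        ((continuous_prob _).mul (continuous_PDbo ends o a₁ a₂ a₃ b))))

/-- The set of weights where (HCOV) holds is closed. -/
theorem isClosed_HCov (ends : E → Sym2 V) (o a₁ a₂ a₃ b : V) :
    IsClosed {p : E → R | HCov p ends o a₁ a₂ a₃ b} :=
  isClosed_le continuous_const (continuous_Gc ends o a₁ a₂ a₃ b)

end Continuity

/-! ## The closure argument -/

section Interior

variable {V : Type*} {E : Type*} [Fintype E] [DecidableEq E] {R : Type*}
  [Field R] [LinearOrder R] [IsStrictOrderedRing R]

/-- **Interior weights suffice**: for a fixed graph and marks, (HCOV) at every interior weight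
gives (HCOV) at every admissible weight (the order topology on `R`; `Gc` continuous; the open
cube dense in the closed cube). -/
theorem HCov_of_int (ends : E → Sym2 V) (o a₁ a₂ a₃ b : V)
    (h : ∀ p : E → R, IsIntVec p → HCov p ends o a₁ a₂ a₃ b) :
    ∀ p : E → R, IsProbVec p → HCov p ends o a₁ a₂ a₃ b := by
  intro p hp
  letI : TopologicalSpace R := Preorder.topology R
  haveI : OrderTopology R := ⟨rfl⟩
  have hcl : IsClosed {q : E → R | HCov q ends o a₁ a₂ a₃ b} := isClosed_HCov ends o a₁ a₂ a₃ b
  have hsub : Set.pi Set.univ (fun _ : E => Set.Ioo (0 : R) 1) ⊆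
      {q : E → R | HCov q ends o a₁ a₂ a₃ b} :=
    fun q hq => h q (isIntVec_iff_mem_pi.2 hq)
  have hmem : p ∈ closure (Set.pi Set.univ (fun _ : E => Set.Ioo (0 : R) 1)) := by
    rw [closure_pi_set]
    have hp' := isProbVec_iff_mem_pi.1 hp
    rw [Set.mem_univ_pi] at hp' ⊢
    intro e
    rw [closure_Ioo zero_ne_one]
    exact hp' e
  exact hcl.closure_subset_iff.2 hsub hmem

end Interior

/-! ## The interior closures -/

section Closure

variable (R : Type*) [Field R] [LinearOrder R] [IsStrictOrderedRing R]

/-- **(HCOV) at interior weights for every finite graph** (labelling-free). -/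
def HCov_int_all : Prop :=
  ∀ (V E : Type) [Fintype V] [DecidableEq V] [Fintype E] [DecidableEq E]
    (ends : E → Sym2 V) (p : E → R), IsIntVec p →
    ∀ o a₁ a₂ a₃ b : V, a₁ ≠ a₂ → a₁ ≠ a₃ → a₂ ≠ a₃ → o ≠ a₁ → o ≠ a₂ → o ≠ a₃ → o ≠ b →
      b ≠ a₁ → b ≠ a₂ → b ≠ a₃ → HCov p ends o a₁ a₂ a₃ b

/-- **(HCOV) on the class of record at interior weights**. -/
def WRed.HCovWRedMinH_int_all : Prop :=
  ∀ (V E : Type) [Fintype V] [DecidableEq V] [Fintype E] [DecidableEq E]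
    (ends : E → Sym2 V) (p : E → R), IsIntVec p →
    ∀ o a₁ a₂ a₃ b : V, a₁ ≠ a₂ → a₁ ≠ a₃ → a₂ ≠ a₃ → o ≠ a₁ → o ≠ a₂ → o ≠ a₃ → o ≠ b →
      b ≠ a₁ → b ≠ a₂ → b ≠ a₃ → WRed.WReducedMinH ends o a₁ a₂ a₃ b → HCov p ends o a₁ a₂ a₃ b

end Closure

section Main

variable {R : Type*} [Field R] [LinearOrder R] [IsStrictOrderedRing R]

/-- **(HCOV) everywhere ⟺ (HCOV) at interior weights.** -/
theorem HCov_all_iff_HCov_int_all : HCov_all R ↔ HCov_int_all R := by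
  constructor
  · intro h V E _ _ _ _ ends p hp o a₁ a₂ a₃ b h12 h13 h23 ho1 ho2 ho3 hob hb1 hb2 hb3
    exact h V E ends p hp.isProbVec o a₁ a₂ a₃ b h12 h13 h23 ho1 ho2 ho3 hob hb1 hb2 hb3
  · intro h V E _ _ _ _ ends p hp o a₁ a₂ a₃ b h12 h13 h23 ho1 ho2 ho3 hob hb1 hb2 hb3
    exact HCov_of_int ends o a₁ a₂ a₃ b
      (fun q hq => h V E ends q hq o a₁ a₂ a₃ b h12 h13 h23 ho1 ho2 ho3 hob hb1 hb2 hb3) p hp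

/-- **(HCOV) on the class of record ⟺ (HCOV) on the class of record at interior weights.** -/
theorem WRed.HCovWRedMinH_all_iff_HCovWRedMinH_int_all :
    WRed.HCovWRedMinH_all R ↔ WRed.HCovWRedMinH_int_all R := by
  constructor
  · intro h V E _ _ _ _ ends p hp o a₁ a₂ a₃ b h12 h13 h23 ho1 ho2 ho3 hob hb1 hb2 hb3 hred
    exact h V E ends p hp.isProbVec o a₁ a₂ a₃ b h12 h13 h23 ho1 ho2 ho3 hob hb1 hb2 hb3 hred
  · intro h V E _ _ _ _ ends p hp o a₁ a₂ a₃ b h12 h13 h23 ho1 ho2 ho3 hob hb1 hb2 hb3 hred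
    exact HCov_of_int ends o a₁ a₂ a₃ b
      (fun q hq => h V E ends q hq o a₁ a₂ a₃ b h12 h13 h23 ho1 ho2 ho3 hob hb1 hb2 hb3 hred)
      p hp

/-- **THE CRUX ON THE CLASS OF RECORD AT INTERIOR WEIGHTS**:
`HCov_all ↔ HCovWRedMinH_int_all`. -/
theorem WRed.HCov_all_iff_HCovWRedMinH_int_all :
    HCov_all R ↔ WRed.HCovWRedMinH_int_all R :=
  WRed.HCov_all_iff_HCovWRedMinH_all.trans WRed.HCovWRedMinH_all_iff_HCovWRedMinH_int_all

end Main

end Summit.Ventures.PercRepro2
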